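import Mathlib.RingTheory.PiTensorProduct
import Mathlib.LinearAlgebra.PiTensorProduct.Basis
import Mathlib.LinearAlgebra.PiTensorProduct.Finite
import Mathlib.LinearAlgebra.Trace
import Mathlib.RingTheory.Trace.Defs
import HarnessLib

/-!
# Traces on finite tensor products: `Tr(⊗_i f_i) = ∏_i Tr(f_i)`

For a finite family of finite free modules `M_i` over a commutative ring `R` and endomorphisms
`f_i` of `M_i`, the trace of `⊗_i f_i` on `⨂[R] i, M_i` is the product of the traces — the
multi-factor form of the Kronecker-product rule `tr(A ⊗ B) = tr(A)·tr(B)` (Mathlib has the binary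
`LinearMap.trace_tensorProduct'` / `Matrix.trace_kronecker`; the `PiTensorProduct` version is not in
Mathlib).  Consequence for algebras: for commutative finite free `R`-algebras `A_i` the algebra trace
of a pure tensor is the product of the traces, `Tr_{(⊗A_i)/R}(⊗_i x_i) = ∏_i Tr_{A_i/R}(x_i)`.

* `Literature.RingTheory.Trace.trace_piTensorProduct_map` — `LinearMap.trace R (⨂ M_i) (⊗ f_i) = ∏ Tr f_i`;
* `Literature.RingTheory.Trace.lmul_tprod_eq_map` — multiplication by `⊗ x_i` is `⊗ (mult. by x_i)`;
* `Literature.RingTheory.Trace.trace_piTensorProduct_tprod` — `Algebra.trace R (⨂ A_i) (⊗ x_i) = ∏ Tr x_i`.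

Proof: in the tensor basis (Mathlib `Basis.piTensorProduct`) the matrix of `⊗ f_i` is the Kronecker
product, whose diagonal entries are products of diagonal entries; then `∑_J ∏_i = ∏_i ∑_j`.
Source for the rule `tr(A ⊗ B) = tr(A) tr(B)`: Fuhrmann–Helmke, *The Mathematics of Networks of
Linear Systems* (2015), §5.2, p. 222 (the finite-product form follows by induction; here it is
proved directly for `PiTensorProduct`).  Consumer: the tensor packets `⊗_{ℚ_p} k_i` of [IUTchIV] §1
(`Literature/IUT/LogVolume/`).  No definitions, no named facts.
-/

noncomputable section

open PiTensorProduct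
open scoped TensorProduct

namespace Literature.RingTheory.Trace

section Modules

variable {R : Type*} [CommRing R] {ι : Type*} [Fintype ι]
  {M : ι → Type*} [∀ i, AddCommGroup (M i)] [∀ i, Module R (M i)]
  [∀ i, Module.Free R (M i)] [∀ i, Module.Finite R (M i)]

/-- **`Tr(⊗_i f_i) = ∏_i Tr(f_i)`** for endomorphisms `f_i` of finite free modules `M_i` over a
commutative ring (multi-factor Kronecker trace rule `tr(A ⊗ B) = tr(A)·tr(B)`).
[cite: FuhrmannHelmke2015, §5.2 p. 222] -/
theorem trace_piTensorProduct_map (f : Π i, M i →ₗ[R] M i) :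
    LinearMap.trace R (⨂[R] i, M i) (PiTensorProduct.map f) =
      ∏ i, LinearMap.trace R (M i) (f i) := by
  classical
  let b : Π i, Module.Basis (Module.Free.ChooseBasisIndex R (M i)) R (M i) :=
    fun i ↦ Module.Free.chooseBasis R (M i)
  let B := Basis.piTensorProduct b
  rw [LinearMap.trace_eq_matrix_trace R B]
  simp_rw [LinearMap.trace_eq_matrix_trace R (b _)]
  simp only [Matrix.trace, Matrix.diag_apply, LinearMap.toMatrix_apply]
  rw [Fintype.prod_sum]
  refine Finset.sum_congr rfl fun J _ ↦ ?_
  rw [show B J = tprod R (fun i ↦ b i (J i)) from Basis.piTensorProduct_apply b J,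
    PiTensorProduct.map_tprod, Basis.piTensorProduct_repr_tprod_apply]

end Modules

section Algebras

variable {R : Type*} [CommRing R] {ι : Type*} [Fintype ι]
  {A : ι → Type*} [∀ i, CommRing (A i)] [∀ i, Algebra R (A i)]

omit [Fintype ι] in
/-- Multiplication by a pure tensor `⊗_i x_i` on `⨂_i A_i` is the tensor product of the
multiplications by the `x_i`. [cite: FuhrmannHelmke2015, §5.2 p. 222] -/
theorem lmul_tprod_eq_map (x : Π i, A i) :
    (Algebra.lmul R (⨂[R] i, A i) (tprod R x) : (⨂[R] i, A i) →ₗ[R] ⨂[R] i, A i) =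
      PiTensorProduct.map fun i ↦ (Algebra.lmul R (A i) (x i) : A i →ₗ[R] A i) := by
  ext y
  simp only [LinearMap.compMultilinearMap_apply, Algebra.coe_lmul_eq_mul, LinearMap.mul_apply',
    PiTensorProduct.map_tprod, tprod_mul_tprod]
  rfl

variable [∀ i, Module.Free R (A i)] [∀ i, Module.Finite R (A i)]

/-- **`Tr_{(⊗_i A_i)/R}(⊗_i x_i) = ∏_i Tr_{A_i/R}(x_i)`**: the algebra trace of a pure tensor in a
finite tensor product of finite free commutative algebras is the product of the traces.
[cite: FuhrmannHelmke2015, §5.2 p. 222] -/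
theorem trace_piTensorProduct_tprod (x : Π i, A i) :
    Algebra.trace R (⨂[R] i, A i) (tprod R x) = ∏ i, Algebra.trace R (A i) (x i) := by
  rw [Algebra.trace_apply, lmul_tprod_eq_map, trace_piTensorProduct_map]
  simp_rw [Algebra.trace_apply]

end Algebras

end Literature.RingTheory.Trace

end
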